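import Mathlib
import Summits.ValiantsHypothesis.ValiantsHypothesis.Theses.FreeSubtorus
import Summits.ValiantsHypothesis.ValiantsHypothesis.Theorems.FreeSubtorusOrbitDimensionBoundSlices

/-!
# `FreeSubtorus.OrbitDimensionBound` (crux stmt-ValiantsHypothesis-16133) — line `homogeneous-grenet`
# (strategist, STRENGTHEN lens): Grenet optimality in two layers — degree symmetry is free, and Grenet
# is optimal among degree-symmetric (homogeneous-ABP) representations

Crux (rank 2 of route-ValiantsHypothesis-FreeSubtorus), BY NAME:
`Summit.ValiantsHypothesis.ValiantsHypothesis.Theses.FreeSubtorus.OrbitDimensionBound` — for `n ≥ 3`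
and every `m`: if `per_n` has an affine determinantal representation of size `m`, then it has one of
the SAME size `m` that is equivariant with exact `GL_m × GL_m` lifts under an admissible subtorus
`T_Λ` of the two-sided torus (`r ≤ n/2` relations of zero row-sum and zero column-sum).

## Why a second line (what it dodges)

The lead's line `Sketch` is closed modulo ONE stub, `stub_smallFace`, which is the crux's exact open
content: `n ≥ 4`, `dc(per_n) ≤ m ≤ 2ⁿ - 2` — a range not known to be inhabited for any `n` (no
representation of `per_n`, `n ≥ 4`, below Grenet's size `2ⁿ - 1` is known; `9 ≤ dc(per_4) ≤ 15`).
Every statement of the shape "∀ A in that range ∃ B …" is VACUITY-TRAPPED: no instance to test, no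
instance to prove.  The tree already shows (`Cruxes/…/Calibration.lean`,
`orbitDimensionBound_of_grenetOptimal`) that GRENET OPTIMALITY `dc(per_n) = 2ⁿ - 1` (all `n ≥ 4`)
implies the crux, and (`orbitDimensionBoundR0At_iff_grenetOptimal`) that the crux's `r = 0` slice is
EQUIVALENT to it.  This line bets on the strengthening and cuts it along the one seam the Disproof file
singles out (§3, `homothetySymmetrisation_of_orbitDimensionBound`: ANY proof of the crux must deliver
homothety lifts at every size):

* **Stub 1 (`stub_homothetyFree`) — DEGREE SYMMETRY IS FREE.**  For `n ≥ 4` and a sub-Grenet size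
  `m ≤ 2ⁿ - 2`: if `per_n` has a size-`m` affine representation, it has one of size `m` on which every
  homothety `x ↦ c·x` (`c ∈ ℂˣ`) lifts exactly.  This is the crux's NECESSARY condition (Disproof §3,
  tree `homothetyLifts_of_orbitDimensionBound`), strictly weaker than the crux (only the rank-`2n-1`
  "lattice" of ALL admissible relations is asked), and it is Landsberg–Ressayre's Question 2.2 for the
  smallest symmetry group `ℂˣ ⊂ G_per`: "can an optimal determinantal expression of `per_n` be made
  quasi-homogeneous (a graded / layered ABP) at no cost?"  In place it is FALSE (Disproof §4: the
  Koszul-twisted Grenet matrix, size `7 = dc(per_3)`, lifts no homothety), so `B ≠ A` in general; the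
  Białynicki-Birula initial form along a grading cocharacter (landed `stub_initialFormAccumulates`) is
  the natural producer of `B` when the non-cancellation cone of `A` contains the degree direction.
* **Stub 2 (`stub_homogeneousGrenetOptimal`) — GRENET IS OPTIMAL AMONG HOMOTHETY-EQUIVARIANT
  REPRESENTATIONS.**  For `n ≥ 4`, every affine representation of `per_n` on which all homotheties
  lift exactly has size `≥ 2ⁿ - 1`.  A homothety-equivariant regular representation is, up to constant
  gauge, a LAYERED (homogeneous) algebraic branching program with `m + 1` vertices (grading by a
  one-parameter subgroup of lifts; `per_n` has only regular representations, von zur Gathen 1987), so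
  the stub reads: **no homogeneous ABP with fewer than `2ⁿ` vertices computes `per_n`** — Grenet's
  `Σ_k C(n,k) = 2ⁿ` is optimal in the homogeneous model, not only in the left-equivariant model of
  Landsberg–Ressayre (Thm. 2.8, `lr_left_equivariant_lower_holds`) or the two-sided-torus model
  (`TorusBound`, proved).  This is a RESTRICTED-MODEL LOWER BOUND — the sibling world of Nisan / Raz /
  Limaye–Srinivasan–Tavenas — universally quantified, hence NOT vacuity-trapped: it is refutable by ONE
  explicit layered ABP (first open case `n = 4`: widths `(4,5,4)`, `(4,4,4)` or `(4,4,5)`, i.e. a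
  rank-`5` preimage of `per_4` under `Sym² ⊗ Sym² → Sym⁴`; strategist kit job j026124 searches exactly
  these shapes numerically), and attackable by restricted-model technique (flattenings along the
  layering, the geometry `V(layer) ⊆ Z(per_n)` of Kumar / Chatterjee–Kumar–She–Volk).
* **Composition (`OrbitDimensionBound_of`, sorry-free).**  `n = 3`: tree slice
  `orbitDimensionBound_three`.  `n ≥ 4`, `m ≥ 2ⁿ - 1`: tree `concl_of_two_pow_le` (pad Grenet,
  `r = 0`).  `n ≥ 4`, `m ≤ 2ⁿ - 2`: stub 1 turns the given `A` into a homothety-equivariant `B` of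
  size `m`, stub 2 gives `m ≥ 2ⁿ - 1` — the range is EMPTY, i.e. the two stubs prove
  `dc(per_n) ≥ 2ⁿ - 1` for `n ≥ 4`, and the crux follows (vacuously there).

Honesty clause.  Stub 2 alone implies `VP ≠ VNP` through standard simulations (a size-`s` determinantal
expression gives a poly(`s`)-vertex ABP, homogenised at a factor `n + 1`), so it is summit-strength — as
one stub of ANY line for this crux must be, because the crux plus the PROVED `SubtorusCovering` already
gives `dc(per_n) ≥ C(n,⌊n/2⌋)/2^{⌊n/2⌋}`.  What the cut buys is TYPE, not ease: a universally quantified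
restricted-model statement with finite falsifiers at every `n`, in exchange for the existential flip.

## Shape (skeleton audit by-name rule)
* `Stmt.stub_homothetyFree`, `Stmt.stub_homogeneousGrenetOptimal` — the stub statements as `Prop`s;
* `stub_…` — the same statements as sorried theorems (the REGISTERED stubs; `sorry` nowhere else);
* `OrbitDimensionBound_of` — the composition (real proof); `OrbitDimensionBound_proof` — the crux by name.
-/

namespace Summit.ValiantsHypothesis.ValiantsHypothesis.Cruxes.OrbitDimensionBound.HomogeneousGrenet

open Matrix MvPolynomial Finset
open Literature.Computability.AlgebraicComplexity
open Summit.ValiantsHypothesis.ValiantsHypothesis.Theorems.FreeSubtorusOrbitDimensionBound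

-- `Summit.ValiantsHypothesis.ValiantsHypothesis.…` is the tree's mandated single-conjunct layout (Sub = Summit).
set_option linter.dupNamespace false

noncomputable section

/-! ## §1 The two stub statements as `Prop`s (named like the registered stubs) -/

/-- Statement of stub 1 (`stub_homothetyFree`) — **degree symmetry is free at sub-Grenet sizes.**
For `n ≥ 4`, `m + 2 ≤ 2ⁿ` and an affine determinantal representation `A` of `per_n` of size `m`, there
is an affine determinantal representation `B` of `per_n` of the same size `m` such that every homothety
`γ = c · 1` (`c ∈ ℂˣ`) of the `n²` variables lifts exactly: `B(c·x) = g · B(x) · h⁻¹` with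
`g, h ∈ GL_m(ℂ)`.  (The crux's necessary condition, Disproof §3 / tree
`homothetyLifts_of_orbitDimensionBound`, on the crux's open range; Landsberg–Ressayre Q2.2 for `ℂˣ`.)
[cite: LandsbergRessayre2017, §2 Q2.2] [cite: IkenmeyerLandsberg2017, §3] -/
def Stmt.stub_homothetyFree : Prop :=
  ∀ n : ℕ, 4 ≤ n → ∀ (m : ℕ), m + 2 ≤ 2 ^ n →
    ∀ (A : Matrix (Fin m) (Fin m) (MvPolynomial (Fin n × Fin n) ℂ)),
    Literature.Computability.AlgebraicComplexity.IsAffineDetRepr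
        (Literature.Computability.AlgebraicComplexity.perPoly (Fin n) ℂ) A →
    ∃ B : Matrix (Fin m) (Fin m) (MvPolynomial (Fin n × Fin n) ℂ),
      Literature.Computability.AlgebraicComplexity.IsAffineDetRepr
          (Literature.Computability.AlgebraicComplexity.perPoly (Fin n) ℂ) B ∧
      ∀ (c : ℂˣ) (γ : GL (Fin n × Fin n) ℂ),
        (γ : Matrix (Fin n × Fin n) (Fin n × Fin n) ℂ) = Matrix.diagonal (fun _ => (c : ℂ)) →
        ∃ g h : GL (Fin m) ℂ, Matrix.linSubstEntries γ B =
          (g : Matrix (Fin m) (Fin m) ℂ).map C * B * ((h⁻¹ : GL (Fin m) ℂ) : Matrix (Fin m) (Fin m) ℂ).map C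

/-- Statement of stub 2 (`stub_homogeneousGrenetOptimal`) — **Grenet is optimal among
homothety-equivariant representations.**  For `n ≥ 4`, an affine determinantal representation `B` of
`per_n` of size `m` on which every homothety `x ↦ c·x` lifts exactly has `2ⁿ - 1 ≤ m`.  (Up to constant
gauge such a `B` is a layered = homogeneous ABP with `m + 1` vertices; the stub says no homogeneous ABP
with `< 2ⁿ` vertices computes `per_n`.  Restricted-model lower bound; first open case `n = 4`.)
[cite: LandsbergRessayre2017, Thm. 2.8] [cite: Grenet2011, Thm. 1] [cite: IkenmeyerLandsberg2017, §2] -/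
def Stmt.stub_homogeneousGrenetOptimal : Prop :=
  ∀ n : ℕ, 4 ≤ n → ∀ (m : ℕ) (B : Matrix (Fin m) (Fin m) (MvPolynomial (Fin n × Fin n) ℂ)),
    Literature.Computability.AlgebraicComplexity.IsAffineDetRepr
        (Literature.Computability.AlgebraicComplexity.perPoly (Fin n) ℂ) B →
    (∀ (c : ℂˣ) (γ : GL (Fin n × Fin n) ℂ),
        (γ : Matrix (Fin n × Fin n) (Fin n × Fin n) ℂ) = Matrix.diagonal (fun _ => (c : ℂ)) →
        ∃ g h : GL (Fin m) ℂ, Matrix.linSubstEntries γ B =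
          (g : Matrix (Fin m) (Fin m) ℂ).map C * B * ((h⁻¹ : GL (Fin m) ℂ) : Matrix (Fin m) (Fin m) ℂ).map C) →
    2 ^ n - 1 ≤ m

/-! ## §2 The registered stubs (the ONLY sorries of this file) -/

/-- **Registered stub 1 = `Stmt.stub_homothetyFree`** (degree symmetry is free at sub-Grenet sizes:
OPEN for every `n ≥ 4` — its hypothesis range is not known to be inhabited; implied by Grenet
optimality; necessary for the crux). [cite: LandsbergRessayre2017, §2 Q2.2] -/
theorem stub_homothetyFree :
    ∀ n : ℕ, 4 ≤ n → ∀ (m : ℕ), m + 2 ≤ 2 ^ n →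
    ∀ (A : Matrix (Fin m) (Fin m) (MvPolynomial (Fin n × Fin n) ℂ)),
    Literature.Computability.AlgebraicComplexity.IsAffineDetRepr
        (Literature.Computability.AlgebraicComplexity.perPoly (Fin n) ℂ) A →
    ∃ B : Matrix (Fin m) (Fin m) (MvPolynomial (Fin n × Fin n) ℂ),
      Literature.Computability.AlgebraicComplexity.IsAffineDetRepr
          (Literature.Computability.AlgebraicComplexity.perPoly (Fin n) ℂ) B ∧
      ∀ (c : ℂˣ) (γ : GL (Fin n × Fin n) ℂ),
        (γ : Matrix (Fin n × Fin n) (Fin n × Fin n) ℂ) = Matrix.diagonal (fun _ => (c : ℂ)) →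
        ∃ g h : GL (Fin m) ℂ, Matrix.linSubstEntries γ B =
          (g : Matrix (Fin m) (Fin m) ℂ).map C * B * ((h⁻¹ : GL (Fin m) ℂ) : Matrix (Fin m) (Fin m) ℂ).map C := by
  sorry

/-- **Registered stub 2 = `Stmt.stub_homogeneousGrenetOptimal`** (Grenet is optimal among
homothety-equivariant = homogeneous-ABP representations of `per_n`, `n ≥ 4`: OPEN restricted-model lower
bound; refutable by one explicit layered ABP of `per_n` with `< 2ⁿ` vertices).
[cite: LandsbergRessayre2017, Thm. 2.8] [cite: Grenet2011, Thm. 1] -/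
theorem stub_homogeneousGrenetOptimal :
    ∀ n : ℕ, 4 ≤ n → ∀ (m : ℕ) (B : Matrix (Fin m) (Fin m) (MvPolynomial (Fin n × Fin n) ℂ)),
    Literature.Computability.AlgebraicComplexity.IsAffineDetRepr
        (Literature.Computability.AlgebraicComplexity.perPoly (Fin n) ℂ) B →
    (∀ (c : ℂˣ) (γ : GL (Fin n × Fin n) ℂ),
        (γ : Matrix (Fin n × Fin n) (Fin n × Fin n) ℂ) = Matrix.diagonal (fun _ => (c : ℂ)) →
        ∃ g h : GL (Fin m) ℂ, Matrix.linSubstEntries γ B =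
          (g : Matrix (Fin m) (Fin m) ℂ).map C * B * ((h⁻¹ : GL (Fin m) ℂ) : Matrix (Fin m) (Fin m) ℂ).map C) →
    2 ^ n - 1 ≤ m := by
  sorry

/-! ## §3 The composition (kernel-checked, sorry-free) -/

/-- **The crux from the two stubs** (real proof).  `n = 3`: tree slice `orbitDimensionBound_three`
(via `orbitDimensionBound_of_four_le`).  `n ≥ 4`: if `2ⁿ - 1 ≤ m`, pad Grenet's two-sided-torus-equivariant
representation (tree `concl_of_two_pow_le`, `r = 0`); otherwise `m + 2 ≤ 2ⁿ`, stub 1 produces a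
homothety-equivariant representation of size `m`, and stub 2 forces `2ⁿ - 1 ≤ m` — the sub-Grenet range
is empty (`dc(per_n) ≥ 2ⁿ - 1`), so the crux holds there vacuously.
[cite: Grenet2011, Thm. 1] [cite: LandsbergRessayre2017, §2 Q2.2] -/
theorem OrbitDimensionBound_of :
    Stmt.stub_homothetyFree → Stmt.stub_homogeneousGrenetOptimal →
      Summit.ValiantsHypothesis.ValiantsHypothesis.Theses.FreeSubtorus.OrbitDimensionBound := by
  intro h₁ h₂
  refine orbitDimensionBound_of_four_le fun n hn m A hA => ?_
  by_cases hm : 2 ^ n - 1 ≤ m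
  · -- Grenet's sizes: pad the two-sided-torus-equivariant representation (tree), `r = 0`
    exact concl_of_two_pow_le (by omega) hm
  · -- sub-Grenet sizes: stub 1 (degree symmetry for free) + stub 2 (homogeneous Grenet optimality)
    -- show the range is empty
    exfalso
    have hm' : m + 2 ≤ 2 ^ n := by
      have h1 : 1 ≤ 2 ^ n := Nat.one_le_two_pow
      omega
    obtain ⟨B, hB, hlift⟩ := h₁ n hn m hm' A hA
    have hge : 2 ^ n - 1 ≤ m := h₂ n hn m B hB hlift
    exact hm hge

/-- **THE SKELETON: the crux BY NAME, modulo exactly the two registered stubs.**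
[cite: LandsbergRessayre2017, §2] -/
theorem OrbitDimensionBound_proof :
    Summit.ValiantsHypothesis.ValiantsHypothesis.Theses.FreeSubtorus.OrbitDimensionBound :=
  OrbitDimensionBound_of stub_homothetyFree stub_homogeneousGrenetOptimal

end

end Summit.ValiantsHypothesis.ValiantsHypothesis.Cruxes.OrbitDimensionBound.HomogeneousGrenet
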